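import Literature.NumberTheory.Sieve.MaynardOrderOneCollapse
import HarnessLib

/-!
# Polymath 8b Lemma 6.1 for the `ε`-enlarged functional with weights of ORDER ONE: the two-atom collapse for `M_{k,ε}`

Topic `Literature/NumberTheory/Sieve`; the `ε`-analogue of `maynardFunctional_le_of_orderOne_twoAtom`
(`MaynardOrderOneCollapse.lean`, the case `ε = 0`) on top of the tree's `ε`-enlarged Lemma 6.1
`MkEps.polymathFunctional_le_of_weights` (`PolymathMkEpsCauchySchwarz.lean`).  Source: D. H. J. Polymath,
*Variants of the Selberg sieve, and bounded intervals containing many primes*, Res. Math. Sci. 1:12 (2014)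
= arXiv:1407.4897v4, §6: Lemma 6.1 (the Cauchy–Schwarz dual bound with weights `G₁,…,G_k`, p. 24) and the
proof of Proposition 6.5 (`M_{k,ε} ≤ k/(k-1)·log(2k-1)`: the same device on the enlarged region
`(1+ε)·R_k` with the fibres `t_m ∈ (0, 1+ε-∑_{j≠m}t_j]` over `∑_{j≠m} t_j ≤ 1-ε`).  For weights of order one,
`G_m(t) = ψ(t_m, ℓ_m)` with FIBRE LENGTH `ℓ_m = 1 + ε - ∑_{j≠m} t_j ∈ [2ε, 1+ε]` and fibre budgets
`∫_{(0,ℓ]} ψ(u,ℓ) du ≤ 1`, the pointwise hypothesis of Lemma 6.1 on the diagonal `∑ t = σ` is a sum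
`∑_m Φ_{σ,ε}(t_m)` of a function of ONE coordinate (`Φ_{σ,ε}(u) = 1/ψ(u, 1+ε-σ+u)` on the active atoms
`0 < u`, `σ - u ≤ 1-ε`, else `0`), and Carathéodory's theorem on the line (Rockafellar, *Convex Analysis*,
Cor. 17.1.5 with `n = 1`; the tree's `MaynardCW.sum_mul_le_of_twoAtomChords_le`) collapses the
`k`-dimensional supremum to two-atom chords:

* `MkEps.orderOnePayoff ψ ε σ u` — the order-one payoff in the `ε`-geometry;
* `MkEps.polymathFunctional_le_of_orderOnePayoff_sum_le` — Lemma 6.1 (enlarged) ⇒ it suffices that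
  `∑_m Φ_{σ,ε}(t_m) ≤ Λ` on `(1+ε)·R_{n+1}`;
* **`MkEps.polymathFunctional_le_of_orderOne_twoAtom`** — it suffices that
  `(n+1)·[(u₂-σ/(n+1))/(u₂-u₁)·Φ_{σ,ε}(u₁) + (σ/(n+1)-u₁)/(u₂-u₁)·Φ_{σ,ε}(u₂)] ≤ Λ` for all `σ ∈ [0, 1+ε]`,
  `0 ≤ u₁ ≤ σ/(n+1) ≤ u₂ ≤ σ`, `u₁ < u₂`; then `(∑_m J_{m,1-ε}(F))/I(F) ≤ Λ` for every test function `F` of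
  Theorem 3.12 on `(1+ε)·R_{n+1}` (`0 ≤ ε`; the requested hypothesis `ε < 1` is not needed and is dropped).

* **`MkEps.polymathFunctional_le_of_orderOne_twoAtom_cell`** (appended; cell seat p3 ROUND-27) — the ε-CELL form:
  one `ψ` table on the `(1+ε₂)`-simplex with the cell payoff `orderOnePayoffCell ψ ε₁ ε₂` certifies
  `polymathFunctional (n+1) ε F ≤ Λ` for all `ε ∈ [ε₁, ε₂]` simultaneously (finite ε-covers of a ceiling certificate).

The statement (signature, hypotheses, namespace) is the one requested by the cell `parity-ideate` seat p3
(ROUND-25 «EPS-CEILING-1» §1.7, `round25/lean/PolymathMkEpsOrderOneTwoAtom.lean`); it is PROVED here, no named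
facts.  For `ε = 0` it is `maynardFunctional_le_of_orderOne_twoAtom` up to the change of functional.

## References
* [Polymath8b2014] D. H. J. Polymath, Res. Math. Sci. 1:12 (2014) = arXiv:1407.4897v4, §6, Lemma 6.1 and the
  proof of Proposition 6.5 (p. 24).
* [Rockafellar1970] R. T. Rockafellar, *Convex Analysis*, Princeton (1970), §17, Corollary 17.1.5 (`n = 1`).
-/

noncomputable section

open MeasureTheory Set Filter Finset
open scoped ENNReal BigOperators

namespace Literature.NumberTheory.Sieve

namespace MkEps

/-! ### The order-one payoff in the `ε`-geometry -/

/-- The ORDER-ONE PAYOFF in the `ε`-geometry: on the diagonal `∑ t = σ`, the atom `u = t_m` is ACTIVE iff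
`0 < u` and `∑_{j≠m} t_j = σ - u ≤ 1 - ε`, and then pays `1/ψ(u, ℓ)` with fibre length `ℓ = 1 + ε - σ + u`;
inactive atoms pay `0`. [cite: Polymath8b2014, Lemma 6.1 and proof of Proposition 6.5 (§6)] -/
def orderOnePayoff (ψ : ℝ → ℝ → ℝ) (ε σ u : ℝ) : ℝ :=
  if 0 < u ∧ σ - u ≤ 1 - ε then (ψ u (1 + ε - σ + u))⁻¹ else 0

/-- [cite: Polymath8b2014, Lemma 6.1 and proof of Proposition 6.5 (§6)] -/
theorem orderOnePayoff_of_active (ψ : ℝ → ℝ → ℝ) {ε σ u : ℝ} (hu : 0 < u) (hσ : σ - u ≤ 1 - ε) :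
    orderOnePayoff ψ ε σ u = (ψ u (1 + ε - σ + u))⁻¹ := if_pos ⟨hu, hσ⟩

/-- [cite: Polymath8b2014, Lemma 6.1 and proof of Proposition 6.5 (§6)] -/
theorem orderOnePayoff_of_not_pos (ψ : ℝ → ℝ → ℝ) {ε σ u : ℝ} (hu : ¬ 0 < u) :
    orderOnePayoff ψ ε σ u = 0 := if_neg fun h => hu h.1

/-- The payoff is nonnegative on `[0, σ]`, `σ ≤ 1 + ε`, when `ψ > 0` on `0 < u ≤ ℓ`, `2ε ≤ ℓ ≤ 1 + ε`.
[cite: Polymath8b2014, Lemma 6.1 and proof of Proposition 6.5 (§6)] -/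
theorem orderOnePayoff_nonneg (ψ : ℝ → ℝ → ℝ) {ε : ℝ}
    (hψpos : ∀ u ℓ : ℝ, 0 < u → u ≤ ℓ → 2 * ε ≤ ℓ → ℓ ≤ 1 + ε → 0 < ψ u ℓ) {σ u : ℝ}
    (hσ : σ ≤ 1 + ε) (hu : u ≤ σ) : 0 ≤ orderOnePayoff ψ ε σ u := by
  unfold orderOnePayoff
  split_ifs with h
  · exact (inv_pos.2 (hψpos _ _ h.1 (by linarith) (by linarith [h.2]) (by linarith))).le
  · exact le_rfl

/-! ### Lemma 6.1 (enlarged) with order-one weights -/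

/-- `1 + ε - ∑_{j≠m} t_j = 1 + ε - ∑ t + t_m`. [folklore] -/
private theorem eps_sub_sum_erase_eq {n : ℕ} (ε : ℝ) (m : Fin (n + 1)) (t : Fin (n + 1) → ℝ) :
    1 + ε - ∑ j ∈ univ.erase m, t j = 1 + ε - ∑ j, t j + t m := by
  have h := MaynardCW.sub_sum_erase_eq m t
  linarith

/-- On a fibre: `∑_{j≠m} (insertNth m u s)_j = ∑ s`. [folklore] -/
private theorem sum_erase_insertNth_eq {n : ℕ} (m : Fin (n + 1)) (u : ℝ) (s : Fin n → ℝ) :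
    ∑ j ∈ univ.erase m, Fin.insertNth (α := fun _ => ℝ) m u s j = ∑ j, s j := by
  have h := MaynardCW.sub_sum_erase_insertNth m u s
  linarith

/-- Core of the order-one collapse in the `ε`-geometry: the enlarged Lemma 6.1
(`MkEps.polymathFunctional_le_of_weights`) for the weights `w_m(t) = 1/ψ(t_m, 1 + ε - ∑_{j≠m} t_j)`; the fibre
budgets come from `∫_{(0,ℓ]} ψ(u,ℓ) du ≤ 1` (`2ε ≤ ℓ ≤ 1+ε`) because the fibre length does not depend on `t_m`,
and the pointwise sum (with its indicators) is `∑_m Φ_{σ,ε}(t_m)`, `σ = ∑ t`.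
[cite: Polymath8b2014, Lemma 6.1 and proof of Proposition 6.5 (§6)] -/
theorem polymathFunctional_le_of_orderOnePayoff_sum_le {n : ℕ} {ε Λ : ℝ}
    (ψ : ℝ → ℝ → ℝ) (hψm : Measurable fun p : ℝ × ℝ => ψ p.1 p.2)
    (hψpos : ∀ u ℓ : ℝ, 0 < u → u ≤ ℓ → 2 * ε ≤ ℓ → ℓ ≤ 1 + ε → 0 < ψ u ℓ)
    (hnorm : ∀ ℓ : ℝ, 2 * ε ≤ ℓ → ℓ ≤ 1 + ε → ∫⁻ u in Ioc (0:ℝ) ℓ, ENNReal.ofReal (ψ u ℓ) ≤ 1)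
    (hΛ0 : 0 ≤ Λ)
    (hpt : ∀ t ∈ scaledSimplex (n + 1) (1 + ε), ∑ m, orderOnePayoff ψ ε (∑ j, t j) (t m) ≤ Λ)
    {F : (Fin (n + 1) → ℝ) → ℝ} (hF : IsPolymathTestFunction (n + 1) ε F) :
    polymathFunctional (n + 1) ε F ≤ Λ := by
  -- the order-one weights
  set w : Fin (n + 1) → (Fin (n + 1) → ℝ) → ℝ :=
    fun m t => (ψ (t m) (1 + ε - ∑ j ∈ univ.erase m, t j))⁻¹ with hw
  have hwm : ∀ m, Measurable (w m) := by
    intro m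
    have h1 : Measurable fun t : Fin (n + 1) → ℝ => (t m, 1 + ε - ∑ j ∈ univ.erase m, t j) :=
      (measurable_pi_apply m).prodMk
        (measurable_const.sub (Finset.measurable_sum _ fun j _ => measurable_pi_apply j))
    exact (hψm.comp h1).inv
  refine polymathFunctional_le_of_weights hΛ0 hF w hwm ?_ ?_ ?_
  · -- positivity where `F ≠ 0`, `t_m > 0`, `∑_{j≠m} t_j ≤ 1 - ε`
    intro m t hFt htm hact
    have ht : t ∈ scaledSimplex (n + 1) (1 + ε) := hF.support_subset (Function.mem_support.2 hFt)
    have hℓ := eps_sub_sum_erase_eq ε m t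
    have hsum_erase : ∑ j ∈ univ.erase m, t j = ∑ j, t j - t m := by linarith
    simp only [hw]
    refine inv_pos.2 (hψpos _ _ htm ?_ ?_ ?_)
    · rw [hℓ]; linarith [ht.2]
    · linarith
    · have : 0 ≤ ∑ j ∈ univ.erase m, t j := Finset.sum_nonneg fun j _ => ht.1 j
      linarith
  · -- fibre budgets
    intro m s hs0 hs1
    have hsum : 0 ≤ ∑ j, s j := Finset.sum_nonneg fun j _ => hs0 j
    calc ∫⁻ u in Ioc (0:ℝ) (1 + ε - ∑ j, s j), ENNReal.ofReal (w m (Fin.insertNth m u s))⁻¹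
        = ∫⁻ u in Ioc (0:ℝ) (1 + ε - ∑ j, s j), ENNReal.ofReal (ψ u (1 + ε - ∑ j, s j)) := by
          refine setLIntegral_congr_fun measurableSet_Ioc fun u hu => ?_
          simp only [hw, sum_erase_insertNth_eq, Fin.insertNth_apply_same, inv_inv]
      _ ≤ 1 := hnorm _ (by linarith) (by linarith)
  · -- the pointwise sum of Lemma 6.1 is `∑_m Φ_{σ,ε}(t_m)`
    intro t ht0 ht1
    have h : ∀ m, (if 0 < t m ∧ ∑ j ∈ univ.erase m, t j ≤ 1 - ε then w m t else 0) =
        orderOnePayoff ψ ε (∑ j, t j) (t m) := by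
      intro m
      have hℓ := eps_sub_sum_erase_eq ε m t
      have hsum_erase : ∑ j ∈ univ.erase m, t j = ∑ j, t j - t m := by linarith
      simp only [hw, orderOnePayoff, hsum_erase]
      split_ifs
      · congr 2; ring
      · rfl
    simpa only [h] using hpt t ⟨ht0, ht1⟩

/-! ### The two-atom collapse -/

/-- **Order-one collapse of the enlarged Lemma 6.1, primal two-atom form** (the `ε`-analogue of
`maynardFunctional_le_of_orderOne_twoAtom`).  Let `0 ≤ ε < 1`, `ψ(u, ℓ) > 0` be jointly measurable with
`∫_{(0,ℓ]} ψ(u, ℓ) du ≤ 1` for `2ε ≤ ℓ ≤ 1 + ε`, and `Φ_{σ,ε} = orderOnePayoff ψ ε σ`.  If for every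
`σ ∈ [0, 1+ε]` and all `0 ≤ u₁ ≤ σ/(n+1) ≤ u₂ ≤ σ`, `u₁ < u₂`, the two-atom value
`(n+1)·[(u₂ - σ/(n+1))/(u₂-u₁)·Φ_{σ,ε}(u₁) + (σ/(n+1) - u₁)/(u₂-u₁)·Φ_{σ,ε}(u₂)]` is `≤ Λ`, then
`(∑_{m=0}^{n} J_{m,1-ε}(F))/I(F) ≤ Λ` for every test function `F` on `(1+ε)·R_{n+1}` (`ε ≥ 0`).  At `t` with `∑ t = σ`
the empirical measure of `t_0,…,t_n` is a probability measure on `[0,σ]` with barycentre `σ/(n+1)`, and by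
Carathéodory's theorem on the line (`MaynardCW.sum_mul_le_of_twoAtomChords_le`) its `Φ_{σ,ε}`-average is
bounded by that of a two-point measure with the same barycentre.
[cite: Polymath8b2014, Lemma 6.1 and proof of Proposition 6.5 (§6); Rockafellar1970, §17, Corollary 17.1.5 (n = 1)] -/
theorem polymathFunctional_le_of_orderOne_twoAtom {n : ℕ} {ε Λ : ℝ} (hε : 0 ≤ ε)
    (ψ : ℝ → ℝ → ℝ) (hψm : Measurable fun p : ℝ × ℝ => ψ p.1 p.2)
    (hψpos : ∀ u ℓ : ℝ, 0 < u → u ≤ ℓ → 2 * ε ≤ ℓ → ℓ ≤ 1 + ε → 0 < ψ u ℓ)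
    (hnorm : ∀ ℓ : ℝ, 2 * ε ≤ ℓ → ℓ ≤ 1 + ε → ∫⁻ u in Ioc (0:ℝ) ℓ, ENNReal.ofReal (ψ u ℓ) ≤ 1)
    (hΛ : ∀ σ ∈ Icc (0:ℝ) (1 + ε), ∀ u₁ u₂ : ℝ, 0 ≤ u₁ → u₁ ≤ σ / ((n:ℝ) + 1) → σ / ((n:ℝ) + 1) ≤ u₂ →
      u₂ ≤ σ → u₁ < u₂ →
      ((n:ℝ) + 1) * ((u₂ - σ / ((n:ℝ) + 1)) / (u₂ - u₁) * orderOnePayoff ψ ε σ u₁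
        + (σ / ((n:ℝ) + 1) - u₁) / (u₂ - u₁) * orderOnePayoff ψ ε σ u₂) ≤ Λ)
    {F : (Fin (n + 1) → ℝ) → ℝ} (hF : IsPolymathTestFunction (n + 1) ε F) :
    polymathFunctional (n + 1) ε F ≤ Λ := by
  have hk : (0:ℝ) < (n:ℝ) + 1 := by positivity
  -- `Λ ≥ 0`: the chord through `u₁ = 0 < u₂ = σ` at `σ = 1 + ε`
  have hΛ0 : 0 ≤ Λ := by
    have h1ε : (0:ℝ) < 1 + ε := by linarith
    have h := hΛ (1 + ε) ⟨h1ε.le, le_rfl⟩ 0 (1 + ε) le_rfl (by positivity)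
      ((div_le_iff₀ hk).2 (by nlinarith)) le_rfl h1ε
    rw [orderOnePayoff_of_not_pos ψ (lt_irrefl 0)] at h
    simp only [mul_zero, zero_add, sub_zero] at h
    have h1 : 0 ≤ orderOnePayoff ψ ε (1 + ε) (1 + ε) := orderOnePayoff_nonneg ψ hψpos le_rfl le_rfl
    have h2 : ((n:ℝ) + 1) * ((1 + ε) / ((n:ℝ) + 1) / (1 + ε) * orderOnePayoff ψ ε (1 + ε) (1 + ε)) =
        orderOnePayoff ψ ε (1 + ε) (1 + ε) := by
      field_simp
    linarith
  refine polymathFunctional_le_of_orderOnePayoff_sum_le ψ hψm hψpos hnorm hΛ0 ?_ hF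
  intro t ht
  set σ : ℝ := ∑ j, t j with hσ
  have hσmem : σ ∈ Icc (0:ℝ) (1 + ε) := ⟨Finset.sum_nonneg fun j _ => ht.1 j, ht.2⟩
  have htm_le : ∀ m, t m ≤ σ := fun m =>
    Finset.single_le_sum (fun j _ => ht.1 j) (Finset.mem_univ m)
  set x : ℝ := σ / ((n:ℝ) + 1) with hx
  -- the chord hypotheses, divided by `n+1`
  have hdeg : x ∈ Icc (0:ℝ) σ → orderOnePayoff ψ ε σ x ≤ Λ / ((n:ℝ) + 1) := by
    intro hxD
    rw [le_div_iff₀' hk]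
    rcases eq_or_lt_of_le hxD.1 with hx0 | hx0
    · rw [← hx0, orderOnePayoff_of_not_pos ψ (lt_irrefl 0), mul_zero]
      exact hΛ0
    · rcases eq_or_lt_of_le hxD.2 with hxσ | hxσ
      · -- `x = σ` (only when `n = 0`): the chord through `0 < σ`
        have h := hΛ σ hσmem 0 σ le_rfl hxD.1 hxD.2 le_rfl (hx0.trans_le hxD.2)
        rw [orderOnePayoff_of_not_pos ψ (lt_irrefl 0)] at h
        have hσ0 : σ ≠ 0 := (hx0.trans_le hxD.2).ne'
        rw [← hx, mul_zero, zero_add, sub_zero, sub_zero, hxσ, div_self hσ0, one_mul] at h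
        rwa [hxσ]
      · -- `x < σ`: the degenerate chord through `x < σ`
        have h := hΛ σ hσmem x σ hxD.1 le_rfl hxσ.le le_rfl hxσ
        rw [← hx] at h
        rwa [sub_self, zero_div, zero_mul, add_zero, div_self (sub_ne_zero.2 hxσ.ne'), one_mul] at h
  have hchord : ∀ a ∈ Icc (0:ℝ) σ, ∀ b ∈ Icc (0:ℝ) σ, a < x → x < b →
      (b - x) / (b - a) * orderOnePayoff ψ ε σ a + (x - a) / (b - a) * orderOnePayoff ψ ε σ b ≤
        Λ / ((n:ℝ) + 1) := by
    intro a haD b hbD hax hxb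
    rw [le_div_iff₀' hk]
    exact hΛ σ hσmem a b haD.1 hax.le hxb.le hbD.2 (hax.trans hxb)
  have key := MaynardCW.sum_mul_le_of_twoAtomChords_le (fun m => t m) hdeg hchord Finset.univ
    (fun _ => 1 / ((n:ℝ) + 1)) (fun _ _ => by positivity)
    (by simp [Finset.card_univ, Fintype.card_fin]; field_simp)
    (by rw [← Finset.mul_sum, ← hσ, hx]; field_simp) (fun m _ => ⟨ht.1 m, htm_le m⟩)
  rw [← Finset.mul_sum, le_div_iff₀ hk] at key
  have e : 1 / ((n:ℝ) + 1) * (∑ m, orderOnePayoff ψ ε σ (t m)) * ((n:ℝ) + 1) =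
      ∑ m, orderOnePayoff ψ ε σ (t m) := by
    field_simp
  linarith

/-! ### The ε-CELL version: one weight table for all `ε ∈ [ε₁, ε₂]` (cell parity-ideate p3 ROUND-27 «EPS-CEILING-2» §0.8 D3)

Requested and written (with complete proof) by seat p3 g24, `round27/lean/PolymathMkEpsOrderOneTwoAtomCell.lean` sha16
0f828426efb80916, landed verbatim: for `0 ≤ ε₁ ≤ ε ≤ ε₂`, ONE table `ψ` on the fibres `ℓ ∈ [ε₁+ε₂, 1+ε₂]` of the LARGEST
simplex `(1+ε₂)·R_k`, with fibre budgets `∫_{(0,ℓ]} ψ(u,ℓ) ≤ 1` and the two-atom chord inequality for the CELL payoff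
(`orderOnePayoffCell`: activity threshold `1-ε₁`, fibre index `1+ε₂-σ+u`), bounds `polymathFunctional (n+1) ε F` for EVERY
`ε ∈ [ε₁, ε₂]` at once (`polymathFunctional_le_of_orderOne_twoAtom_cell`): the fibre index `1+ε₂-∑_{j≠m}t_j` dominates the
true fibre length, `lintegral` is monotone in the set, activity for `ε` implies activity for `ε₁`, payoffs are `≥ 0`, then
`MaynardCW.sum_mul_le_of_twoAtomChords_le` as in the point version (which is the case `ε₁ = ε₂ = ε`,
`orderOnePayoffCell_self`). -/

/-- The ORDER-ONE CELL PAYOFF for the ε-cell `[ε₁, ε₂]`: on the diagonal `∑ t = σ` of the simplex of scale `1+ε₂`,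
the atom `u` is ACTIVE iff `0 < u` and `σ - u ≤ 1 - ε₁`, and then pays `1/ψ(u, 1 + ε₂ - σ + u)`; else `0`.
For `ε₁ = ε₂ = ε` this is `orderOnePayoff ψ ε σ u`. [cite: Polymath8b2014, proof of Proposition 6.5 (§6)] -/
def orderOnePayoffCell (ψ : ℝ → ℝ → ℝ) (ε₁ ε₂ σ u : ℝ) : ℝ :=
  if 0 < u ∧ σ - u ≤ 1 - ε₁ then (ψ u (1 + ε₂ - σ + u))⁻¹ else 0

/-- The cell payoff of the degenerate cell `[ε, ε]` is the point payoff. [cite: Polymath8b2014, Lemma 6.1 and proof of Proposition 6.5 (§6)] -/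
theorem orderOnePayoffCell_self (ψ : ℝ → ℝ → ℝ) (ε σ u : ℝ) :
    orderOnePayoffCell ψ ε ε σ u = orderOnePayoff ψ ε σ u := rfl

/-- Inactive atoms pay nothing. [cite: Polymath8b2014, Lemma 6.1 and proof of Proposition 6.5 (§6)] -/
theorem orderOnePayoffCell_of_not_pos (ψ : ℝ → ℝ → ℝ) {ε₁ ε₂ σ u : ℝ} (hu : ¬ 0 < u) :
    orderOnePayoffCell ψ ε₁ ε₂ σ u = 0 := by
  unfold orderOnePayoffCell
  rw [if_neg (fun h => hu h.1)]

/-- The cell payoff is nonnegative on `u ≤ σ ≤ 1 + ε₂` when `ψ > 0` on the fibres `ℓ ∈ [ε₁+ε₂, 1+ε₂]`. [cite: Polymath8b2014, Lemma 6.1 and proof of Proposition 6.5 (§6)] -/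
theorem orderOnePayoffCell_nonneg (ψ : ℝ → ℝ → ℝ) {ε₁ ε₂ σ u : ℝ}
    (hψpos : ∀ u ℓ : ℝ, 0 < u → u ≤ ℓ → ε₁ + ε₂ ≤ ℓ → ℓ ≤ 1 + ε₂ → 0 < ψ u ℓ)
    (hσ : σ ≤ 1 + ε₂) (huσ : u ≤ σ) : 0 ≤ orderOnePayoffCell ψ ε₁ ε₂ σ u := by
  unfold orderOnePayoffCell
  split_ifs with h
  · exact (inv_pos.2 (hψpos _ _ h.1 (by linarith) (by linarith [h.2]) (by linarith))).le
  · exact le_rfl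

/-- `1 + ε - ∑_{j≠m} t_j = 1 + ε - ∑ t + t_m`. [folklore] -/
private theorem eps_sub_sum_erase_eq' {n : ℕ} (ε : ℝ) (m : Fin (n + 1)) (t : Fin (n + 1) → ℝ) :
    1 + ε - ∑ j ∈ univ.erase m, t j = 1 + ε - ∑ j, t j + t m := by
  have h := MaynardCW.sub_sum_erase_eq m t
  linarith

/-- On a fibre: `∑_{j≠m} (insertNth m u s)_j = ∑ s`. [folklore] -/
private theorem sum_erase_insertNth_eq' {n : ℕ} (m : Fin (n + 1)) (u : ℝ) (s : Fin n → ℝ) :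
    ∑ j ∈ univ.erase m, Fin.insertNth (α := fun _ => ℝ) m u s j = ∑ j, s j := by
  have h := MaynardCW.sub_sum_erase_insertNth m u s
  linarith

/-- Core of the cell domination: the enlarged Lemma 6.1 (`MkEps.polymathFunctional_le_of_weights`) for the test
function's own `ε ∈ [ε₁, ε₂]` with the CELL weights `w_m(t) = 1/ψ(t_m, 1 + ε₂ - ∑_{j≠m} t_j)`: the fibre of length
`1 + ε - ∑ s` is contained in `(0, 1 + ε₂ - ∑ s]`, where `ψ(·, 1 + ε₂ - ∑ s)` has budget `≤ 1`, and the pointwise sum with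
the `ε`-indicators is dominated by `∑_m Φ^{cell}_{σ}(t_m)` because activity for `ε` implies activity for `ε₁` and the
cell payoffs are nonnegative. [cite: Polymath8b2014, Lemma 6.1 and proof of Proposition 6.5 (§6)] -/
theorem polymathFunctional_le_of_orderOnePayoffCell_sum_le {n : ℕ} {ε₁ ε₂ ε Λ : ℝ}
    (h₁ : ε₁ ≤ ε) (h₂ : ε ≤ ε₂)
    (ψ : ℝ → ℝ → ℝ) (hψm : Measurable fun p : ℝ × ℝ => ψ p.1 p.2)
    (hψpos : ∀ u ℓ : ℝ, 0 < u → u ≤ ℓ → ε₁ + ε₂ ≤ ℓ → ℓ ≤ 1 + ε₂ → 0 < ψ u ℓ)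
    (hnorm : ∀ ℓ : ℝ, ε₁ + ε₂ ≤ ℓ → ℓ ≤ 1 + ε₂ → ∫⁻ u in Ioc (0:ℝ) ℓ, ENNReal.ofReal (ψ u ℓ) ≤ 1)
    (hΛ0 : 0 ≤ Λ)
    (hpt : ∀ t ∈ scaledSimplex (n + 1) (1 + ε), ∑ m, orderOnePayoffCell ψ ε₁ ε₂ (∑ j, t j) (t m) ≤ Λ)
    {F : (Fin (n + 1) → ℝ) → ℝ} (hF : IsPolymathTestFunction (n + 1) ε F) :
    polymathFunctional (n + 1) ε F ≤ Λ := by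
  -- the cell weights
  set w : Fin (n + 1) → (Fin (n + 1) → ℝ) → ℝ :=
    fun m t => (ψ (t m) (1 + ε₂ - ∑ j ∈ univ.erase m, t j))⁻¹ with hw
  have hwm : ∀ m, Measurable (w m) := by
    intro m
    have h1 : Measurable fun t : Fin (n + 1) → ℝ => (t m, 1 + ε₂ - ∑ j ∈ univ.erase m, t j) :=
      (measurable_pi_apply m).prodMk
        (measurable_const.sub (Finset.measurable_sum _ fun j _ => measurable_pi_apply j))
    exact (hψm.comp h1).inv
  refine polymathFunctional_le_of_weights hΛ0 hF w hwm ?_ ?_ ?_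
  · -- positivity where `F ≠ 0`, `t_m > 0`, `∑_{j≠m} t_j ≤ 1 - ε`
    intro m t hFt htm hact
    have ht : t ∈ scaledSimplex (n + 1) (1 + ε) := hF.support_subset (Function.mem_support.2 hFt)
    have hℓ := eps_sub_sum_erase_eq' ε₂ m t
    have hsum_erase : ∑ j ∈ univ.erase m, t j = ∑ j, t j - t m := by linarith
    simp only [hw]
    refine inv_pos.2 (hψpos _ _ htm ?_ ?_ ?_)
    · rw [hℓ]; linarith [ht.2]
    · linarith
    · have : 0 ≤ ∑ j ∈ univ.erase m, t j := Finset.sum_nonneg fun j _ => ht.1 j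
      linarith
  · -- fibre budgets: the true fibre `(0, 1+ε-∑s]` sits inside `(0, 1+ε₂-∑s]`
    intro m s hs0 hs1
    have hsum : 0 ≤ ∑ j, s j := Finset.sum_nonneg fun j _ => hs0 j
    have hsub : Ioc (0:ℝ) (1 + ε - ∑ j, s j) ⊆ Ioc (0:ℝ) (1 + ε₂ - ∑ j, s j) :=
      Ioc_subset_Ioc le_rfl (by linarith)
    calc ∫⁻ u in Ioc (0:ℝ) (1 + ε - ∑ j, s j), ENNReal.ofReal (w m (Fin.insertNth m u s))⁻¹
        = ∫⁻ u in Ioc (0:ℝ) (1 + ε - ∑ j, s j), ENNReal.ofReal (ψ u (1 + ε₂ - ∑ j, s j)) := by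
          refine setLIntegral_congr_fun measurableSet_Ioc fun u hu => ?_
          simp only [hw, sum_erase_insertNth_eq', Fin.insertNth_apply_same, inv_inv]
      _ ≤ ∫⁻ u in Ioc (0:ℝ) (1 + ε₂ - ∑ j, s j), ENNReal.ofReal (ψ u (1 + ε₂ - ∑ j, s j)) :=
          lintegral_mono_set hsub
      _ ≤ 1 := hnorm _ (by linarith) (by linarith)
  · -- the pointwise sum of Lemma 6.1 is dominated by `∑_m Φ^{cell}_{σ}(t_m)`
    intro t ht0 ht1
    have hσle : ∑ j, t j ≤ 1 + ε₂ := by linarith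
    have h : ∀ m, (if 0 < t m ∧ ∑ j ∈ univ.erase m, t j ≤ 1 - ε then w m t else 0) ≤
        orderOnePayoffCell ψ ε₁ ε₂ (∑ j, t j) (t m) := by
      intro m
      have hℓ := eps_sub_sum_erase_eq' ε₂ m t
      have hsum_erase : ∑ j ∈ univ.erase m, t j = ∑ j, t j - t m := by linarith
      have htm_le : t m ≤ ∑ j, t j := Finset.single_le_sum (fun j _ => ht0 j) (Finset.mem_univ m)
      split_ifs with hc
      · -- active for `ε`, hence active for `ε₁`, and the weight IS the cell payoff
        have hact : 0 < t m ∧ ∑ j, t j - t m ≤ 1 - ε₁ := ⟨hc.1, by linarith [hc.2]⟩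
        unfold orderOnePayoffCell
        rw [if_pos hact, hw]
        apply le_of_eq
        simp only [hsum_erase]
        congr 2; ring
      · exact orderOnePayoffCell_nonneg ψ hψpos hσle htm_le
    calc ∑ m, (if 0 < t m ∧ ∑ j ∈ univ.erase m, t j ≤ 1 - ε then w m t else 0)
        ≤ ∑ m, orderOnePayoffCell ψ ε₁ ε₂ (∑ j, t j) (t m) := Finset.sum_le_sum fun m _ => h m
      _ ≤ Λ := hpt t ⟨ht0, ht1⟩

/-- **Order-one collapse, ε-CELL two-atom form.**  Let `0 ≤ ε₁ ≤ ε ≤ ε₂`, `ψ(u, ℓ) > 0` jointly measurable with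
`∫_{(0,ℓ]} ψ(u, ℓ) du ≤ 1` for `ε₁ + ε₂ ≤ ℓ ≤ 1 + ε₂`, and `Φ^{cell}_σ = orderOnePayoffCell ψ ε₁ ε₂ σ`.  If for every
`σ ∈ [0, 1+ε₂]` and all `0 ≤ u₁ ≤ σ/(n+1) ≤ u₂ ≤ σ`, `u₁ < u₂`, the two-atom value
`(n+1)·[(u₂ - σ/(n+1))/(u₂-u₁)·Φ^{cell}_σ(u₁) + (σ/(n+1) - u₁)/(u₂-u₁)·Φ^{cell}_σ(u₂)]` is `≤ Λ`, then
`(∑_{m=0}^{n} J_{m,1-ε}(F))/I(F) ≤ Λ` for every test function `F` on `(1+ε)·R_{n+1}` — ONE table `ψ` serves the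
whole cell `ε ∈ [ε₁, ε₂]`.  With `ε₁ = ε₂ = ε` this is `polymathFunctional_le_of_orderOne_twoAtom`.
[cite: Polymath8b2014, Lemma 6.1 and proof of Proposition 6.5 (§6); Rockafellar1970, §17, Corollary 17.1.5 (n = 1)] -/
theorem polymathFunctional_le_of_orderOne_twoAtom_cell {n : ℕ} {ε₁ ε₂ ε Λ : ℝ} (hε₁ : 0 ≤ ε₁)
    (h₁ : ε₁ ≤ ε) (h₂ : ε ≤ ε₂)
    (ψ : ℝ → ℝ → ℝ) (hψm : Measurable fun p : ℝ × ℝ => ψ p.1 p.2)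
    (hψpos : ∀ u ℓ : ℝ, 0 < u → u ≤ ℓ → ε₁ + ε₂ ≤ ℓ → ℓ ≤ 1 + ε₂ → 0 < ψ u ℓ)
    (hnorm : ∀ ℓ : ℝ, ε₁ + ε₂ ≤ ℓ → ℓ ≤ 1 + ε₂ → ∫⁻ u in Ioc (0:ℝ) ℓ, ENNReal.ofReal (ψ u ℓ) ≤ 1)
    (hΛ : ∀ σ ∈ Icc (0:ℝ) (1 + ε₂), ∀ u₁ u₂ : ℝ, 0 ≤ u₁ → u₁ ≤ σ / ((n:ℝ) + 1) → σ / ((n:ℝ) + 1) ≤ u₂ →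
      u₂ ≤ σ → u₁ < u₂ →
      ((n:ℝ) + 1) * ((u₂ - σ / ((n:ℝ) + 1)) / (u₂ - u₁) * orderOnePayoffCell ψ ε₁ ε₂ σ u₁
        + (σ / ((n:ℝ) + 1) - u₁) / (u₂ - u₁) * orderOnePayoffCell ψ ε₁ ε₂ σ u₂) ≤ Λ)
    {F : (Fin (n + 1) → ℝ) → ℝ} (hF : IsPolymathTestFunction (n + 1) ε F) :
    polymathFunctional (n + 1) ε F ≤ Λ := by
  have hk : (0:ℝ) < (n:ℝ) + 1 := by positivity
  have hε₂ : 0 ≤ ε₂ := le_trans hε₁ (h₁.trans h₂)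
  -- `Λ ≥ 0`: the chord through `u₁ = 0 < u₂ = σ` at `σ = 1 + ε₂`
  have hΛ0 : 0 ≤ Λ := by
    have h1ε : (0:ℝ) < 1 + ε₂ := by linarith
    have h := hΛ (1 + ε₂) ⟨h1ε.le, le_rfl⟩ 0 (1 + ε₂) le_rfl (by positivity)
      ((div_le_iff₀ hk).2 (by nlinarith)) le_rfl h1ε
    rw [orderOnePayoffCell_of_not_pos ψ (lt_irrefl 0)] at h
    simp only [mul_zero, zero_add, sub_zero] at h
    have h1 : 0 ≤ orderOnePayoffCell ψ ε₁ ε₂ (1 + ε₂) (1 + ε₂) :=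
      orderOnePayoffCell_nonneg ψ hψpos le_rfl le_rfl
    have h2 : ((n:ℝ) + 1) * ((1 + ε₂) / ((n:ℝ) + 1) / (1 + ε₂) * orderOnePayoffCell ψ ε₁ ε₂ (1 + ε₂) (1 + ε₂)) =
        orderOnePayoffCell ψ ε₁ ε₂ (1 + ε₂) (1 + ε₂) := by
      field_simp
    linarith
  refine polymathFunctional_le_of_orderOnePayoffCell_sum_le h₁ h₂ ψ hψm hψpos hnorm hΛ0 ?_ hF
  intro t ht
  set σ : ℝ := ∑ j, t j with hσ
  have hσmem : σ ∈ Icc (0:ℝ) (1 + ε₂) := ⟨Finset.sum_nonneg fun j _ => ht.1 j, by linarith [ht.2]⟩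
  have htm_le : ∀ m, t m ≤ σ := fun m =>
    Finset.single_le_sum (fun j _ => ht.1 j) (Finset.mem_univ m)
  set x : ℝ := σ / ((n:ℝ) + 1) with hx
  set Φ : ℝ → ℝ := fun u => orderOnePayoffCell ψ ε₁ ε₂ σ u with hΦ
  -- the chord hypotheses, divided by `n+1`
  have hdeg : x ∈ Icc (0:ℝ) σ → Φ x ≤ Λ / ((n:ℝ) + 1) := by
    intro hxD
    simp only [hΦ]
    rw [le_div_iff₀' hk]
    rcases eq_or_lt_of_le hxD.1 with hx0 | hx0
    · rw [← hx0, orderOnePayoffCell_of_not_pos ψ (lt_irrefl 0), mul_zero]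
      exact hΛ0
    · rcases eq_or_lt_of_le hxD.2 with hxσ | hxσ
      · -- `x = σ` (only when `n = 0`): the chord through `0 < σ`
        have h := hΛ σ hσmem 0 σ le_rfl hxD.1 hxD.2 le_rfl (hx0.trans_le hxD.2)
        rw [orderOnePayoffCell_of_not_pos ψ (lt_irrefl 0)] at h
        have hσ0 : σ ≠ 0 := (hx0.trans_le hxD.2).ne'
        rw [← hx, mul_zero, zero_add, sub_zero, sub_zero, hxσ, div_self hσ0, one_mul] at h
        rwa [hxσ]
      · -- `x < σ`: the degenerate chord through `x < σ`
        have h := hΛ σ hσmem x σ hxD.1 le_rfl hxσ.le le_rfl hxσ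
        rw [← hx] at h
        rwa [sub_self, zero_div, zero_mul, add_zero, div_self (sub_ne_zero.2 hxσ.ne'), one_mul] at h
  have hchord : ∀ a ∈ Icc (0:ℝ) σ, ∀ b ∈ Icc (0:ℝ) σ, a < x → x < b →
      (b - x) / (b - a) * Φ a + (x - a) / (b - a) * Φ b ≤ Λ / ((n:ℝ) + 1) := by
    intro a haD b hbD hax hxb
    simp only [hΦ]
    rw [le_div_iff₀' hk]
    exact hΛ σ hσmem a b haD.1 hax.le hxb.le hbD.2 (hax.trans hxb)
  have key := MaynardCW.sum_mul_le_of_twoAtomChords_le (fun m => t m) hdeg hchord Finset.univ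
    (fun _ => 1 / ((n:ℝ) + 1)) (fun _ _ => by positivity)
    (by simp [Finset.card_univ, Fintype.card_fin]; field_simp)
    (by rw [← Finset.mul_sum, ← hσ, hx]; field_simp) (fun m _ => ⟨ht.1 m, htm_le m⟩)
  rw [← Finset.mul_sum, le_div_iff₀ hk] at key
  have e : 1 / ((n:ℝ) + 1) * (∑ m, Φ (t m)) * ((n:ℝ) + 1) = ∑ m, Φ (t m) := by
    field_simp
  simp only [hΦ] at key e ⊢
  linarith

end MkEps

end Literature.NumberTheory.Sieve
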